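import Summits.QuantumFields.Balaban3D.Carriers.RadialIdent
import Summits.QuantumFields.YangMills.Theorems.BalabanUVNodesN07Lemma1BlockGauge
import HarnessLib

/-!
# DAG node N07 [B11], road (S) of the lane owner's word — the WITHIN-BLOCK LETTER IN THE RADIAL AXIAL GAUGE: on a block `B(y)` whose plaquettes are
# `a`-small, a configuration axial for the contour system `Γ_{y,x}` of [B5] (1.7) ∕ [6] (1.15) has EVERY bond with both ends in `B(y)`
# `τ(d,L)·a`-close to `1`, `τ(d,L) = (d(L−1)+1)(d−1)(L−1)`

Cell `pub-ymgap` (HUMAN RULINGS D-0062 ∕ D-0149 ∕ D-0154), width seat `pub-ymgap-dag-n07-w5` g2, 2026-08-28.  `--kind proof --supports <K1 key>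
--as helper` (count-neutral; CLAIM-6 cell bus 11:27Z on dag-n07-e g21's ROAD WORD (S) I.36806: «GO on the radial within-block letter»).  The consumer is
dag-n07-w6's (155)-down-the-tower composition (`…N07RadialAxialTower` ∕ `…N07DataDownTheTower`), which keeps the within-block letters `τ_j` DISPLAYED
until this lands.

THE PRINT.  [B5] = T. Bałaban, CMP **95** (1984) 17–40 `[Balaban1984PropagatorsI]`, (1.7) p. 18 (the contours `Γ_{y,x}`: last coordinate first; typed by
pub-balaban3d as `Carriers.RadialContour.radialContourData`); [6] = CMP **99** (1985) 75–102 `[Balaban1985RegularSpaces]`, (1.15) p. 78 (the axial gauge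
`U(Γ_{x₁,x}) = 1 for x ∈ B(x₁)`) and pp. 79–80, proof of Lemma 1: «The conditions (R₀V′)(Γ_{y,x}) = 1, x ∈ B(y), imply V′_b = 1 for b ⊂ Γ_{y,x}. This
and the above estimate imply |V′_b − 1| < (d−1)(L−1)2α₀L⁻² for b ⊂ B(y)»; [B11] = CMP **102** (1985) 277–309 `[Balaban1985Variational]`, p. 300
(«U′_k ∈ Ax_k(𝔅(k), 1)»).  Nothing is cited as a hypothesis.

WHAT THIS FILE DOES (any `[GaugeGroup G]`, standing range `j + 1 ≤ m + K`; pure bookkeeping over pv26's torus non-abelian Poincaré lemma as packaged in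
g0's `…N07Lemma1BlockGauge.exists_blockwiseGauge` and pub-balaban3d's radial geometry `Carriers.RadialForest` ∕ `RadialContour` ∕ `RadialIdent`):
* §1 the `dist1` twins of pub-balaban3d's `fwdHol_eq_one` ∕ `bwdHol_eq_one` ∕ `moveHol_eq_one` ∕ `pathHol_eq_one`: if every bond of the radial forest
  `radialBonds {y}` is `τ`-close to `1`, then a coordinate move of `Γ_{y,x}` inside `B(y)` is `((L−1)∕2)·τ`-close (`dist1_moveHol_le`) and the whole
  contour holonomy `U(Γ_{y,x})`, `x ∈ B(y)`, is `d·((L−1)∕2)·τ`-close to `1` (★★ `dist1_radialHol_le`); `blockOf_tgt_of_mem_radialBonds`.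
* §2 ★★★ `dist1_le_of_axialGauge_radial`: for `W` with `AxialGauge (radialContourData P j G) W` and `dist1 (W(∂q)) < a` for the plaquettes based in
  `B(y)`: `dist1 (W b) ≤ (d(L−1)+1)·(d−1)(L−1)·a` for every bond `b` with both ends in `B(y)` — by CONJUGATION: g0's block-wise gauge `g` (`g ∘ emb = 1`,
  every bond of `B(y)` of `W^g` is `(d−1)(L−1)a`-close) satisfies `g(x)⁻¹ = (W^g)(Γ_{y,x})` (radial covariance + the axial gauge), so `dist1 (g x) ≤
  d((L−1)∕2)(d−1)(L−1)a`, and `W b = g(b₋)⁻¹ (W^g b) g(b₊)`; `dist1_le_of_axialGauge_radial_hint` (the shape of the `hint` binder of g0's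
  `…Lemma1CrossingBondsAtRecord.dist1_crossingBond_le_at_record`).

HONEST FRAMING (binding).  Count-neutral helper; the constant `τ(d,L) = (d(L−1)+1)(d−1)(L−1)` is CRUDE (conjugation route, degree 4 in `dL`): print's ∕
the ladder's `(d−1)(L−1)∕2` needs a torus dictionary between `Carriers.RadialContour.pathHol` and b07∕pv26's `ℤ^d` ladder words and is NOT typed here;
one level, one block, configuration-level only (no measure theory); (155) down the tower stays dag-n07-w6's composition; asserts NOTHING of [B11]∕[6]∕[3]'s
analysis; `hker` ∕ stub 1 ∕ K0⁷ ∕ K1⁹ NOT closed; N07 NOT discharged; counts unmoved; no summit statement is proved by this seat — R4 closes the conditional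
finite-𝕋⁴ rung `BalabanLadder.UV` only; nothing continuum ∕ ℝ⁴ ∕ OS ∕ mass gap ∕ Clay.  No `sorry`, no `def`, no `instance`, no `notation`.
-/

noncomputable section

namespace Summit.QuantumFields.YangMills.BalabanUVNodes.N07RadialGaugeWithinBlock

open Literature.MathematicalPhysics.QuantumFieldTheory.Balaban1983to89
open Summit.QuantumFields.Balaban3D.Carriers
open Summit.QuantumFields.YangMills.BalabanUVNodes.N07Lemma1BlockGauge (exists_blockwiseGauge)
open GaugeField (gaugeAct)

variable {P : Params} {j : ℕ} {G : Type*} [GaugeGroup G]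

/-! ## §1  Contour holonomies in `dist1` when the radial forest is `τ`-close to `1` -/

section Segments

/-- A forward segment whose bonds are `τ`-close to `1` has holonomy `n·τ`-close to `1`. [folklore] -/
theorem dist1_fwdHol_le (U : GaugeField P j G) (μ : Fin P.d) {τ : ℝ} :
    ∀ (n : ℕ) (z : Site P j), (∀ i, i < n → dist1 (U ⟨shiftN z μ i, μ⟩) ≤ τ) → dist1 (fwdHol U μ n z) ≤ n * τ
  | 0, _, _ => by simp [fwdHol, GaugeGroup.dist1_one]
  | n + 1, z, h => by
    have h0 : dist1 (U ⟨z, μ⟩) ≤ τ := h 0 (Nat.succ_pos n)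
    have ht : dist1 (fwdHol U μ n (z.shift μ)) ≤ n * τ :=
      dist1_fwdHol_le U μ n (z.shift μ) fun i hi => h (i + 1) (by omega)
    simp only [fwdHol]
    calc dist1 (U ⟨z, μ⟩ * fwdHol U μ n (z.shift μ))
        ≤ dist1 (U ⟨z, μ⟩) + dist1 (fwdHol U μ n (z.shift μ)) := GaugeGroup.dist1_mul_le _ _
      _ ≤ τ + n * τ := add_le_add h0 ht
      _ = (n + 1 : ℕ) * τ := by push_cast; ring

/-- A backward segment whose bonds are `τ`-close to `1` has holonomy `n·τ`-close to `1`. [folklore] -/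
theorem dist1_bwdHol_le (U : GaugeField P j G) (μ : Fin P.d) {τ : ℝ} :
    ∀ (n : ℕ) (z : Site P j), (∀ i, i < n → dist1 (U ⟨unshiftN z μ (i + 1), μ⟩) ≤ τ) → dist1 (bwdHol U μ n z) ≤ n * τ
  | 0, _, _ => by simp [bwdHol, GaugeGroup.dist1_one]
  | n + 1, z, h => by
    have h0 : dist1 (U ⟨z.unshift μ, μ⟩) ≤ τ := h 0 (Nat.succ_pos n)
    have ht : dist1 (bwdHol U μ n (z.unshift μ)) ≤ n * τ :=
      dist1_bwdHol_le U μ n (z.unshift μ) fun i hi => h (i + 1) (by omega)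
    simp only [bwdHol]
    calc dist1 ((U ⟨z.unshift μ, μ⟩)⁻¹ * bwdHol U μ n (z.unshift μ))
        ≤ dist1 ((U ⟨z.unshift μ, μ⟩)⁻¹) + dist1 (bwdHol U μ n (z.unshift μ)) := GaugeGroup.dist1_mul_le _ _
      _ ≤ τ + n * τ := by rw [GaugeGroup.dist1_inv]; exact add_le_add h0 ht
      _ = (n + 1 : ℕ) * τ := by push_cast; ring

/-- ★ ONE COORDINATE MOVE of `Γ_{y,x}` inside the block is `((L−1)∕2)·τ`-close to `1` once the forest of `B(y)` is `τ`-close to `1`: from `z ∈ B(y)`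
at the centre in the coordinates `≤ μ`, moving the coordinate `μ` to that of `x ∈ B(y)` (pub-balaban3d's `moveHol_eq_one` in `dist1`; the move runs
over at most `(L−1)∕2` forest bonds, `shiftN∕unshiftN_mem_radialBonds`). [cite: Balaban1984PropagatorsI, (1.7) p.18; folklore] -/
theorem dist1_moveHol_le (hj : j + 1 ≤ P.m + P.K) {y : Site P (j + 1)} (U : GaugeField P j G) {τ : ℝ} (hτ : 0 ≤ τ)
    (hU : ∀ b ∈ radialBonds ({y} : Finset (Site P (j + 1))), dist1 (U b) ≤ τ) {z x : Site P j}
    (hz : blockOf z = y) (hx : blockOf x = y) {μ : Fin P.d} (hlow : ∀ κ, κ < μ → off z κ = (P.L - 1) / 2)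
    (hzμ : off z μ = (P.L - 1) / 2) :
    dist1 (moveHol U μ (x μ) z) ≤ (((P.L - 1) / 2 : ℕ) : ℝ) * τ := by
  have hL := P.hL.2
  obtain ⟨r, hr⟩ := P.hL.1
  have hN := AveragingReflection.two_mul_L_le_sitesPerDir hj
  have hzv := val_eq_of_blockOf hj hz μ
  have hxv := val_eq_of_blockOf hj hx μ
  have hsx : off x μ < P.L := off_lt x μ
  unfold moveHol
  by_cases hcase : (P.L - 1) / 2 ≤ off x μ
  · -- forward over `off x − (L−1)∕2 ≤ (L−1)∕2` forest bonds
    have hsub : (x μ - z μ).val = off x μ - (P.L - 1) / 2 := by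
      rw [ZMod.val_sub (by rw [hxv, hzv]; omega), hxv, hzv]; omega
    have hle : (x μ - z μ).val ≤ (z μ - x μ).val := by
      by_cases heq : x μ = z μ
      · simp [heq]
      · have hne : x μ - z μ ≠ 0 := sub_ne_zero.mpr heq
        have : (z μ - x μ) = -(x μ - z μ) := by ring
        rw [this, ZMod.neg_val, if_neg hne, hsub]
        omega
    rw [if_pos hle, hsub]
    have hcount : ((off x μ - (P.L - 1) / 2 : ℕ) : ℝ) ≤ (((P.L - 1) / 2 : ℕ) : ℝ) := by
      exact_mod_cast (show off x μ - (P.L - 1) / 2 ≤ (P.L - 1) / 2 by omega)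
    refine (dist1_fwdHol_le U μ _ z fun i hi => hU _ ?_).trans (mul_le_mul_of_nonneg_right hcount hτ)
    exact shiftN_mem_radialBonds hj hz hlow i (by omega)
  · -- backward over `(L−1)∕2 − off x ≤ (L−1)∕2` forest bonds
    rw [not_le] at hcase
    have hsub : (z μ - x μ).val = (P.L - 1) / 2 - off x μ := by
      rw [ZMod.val_sub (by rw [hxv, hzv]; omega), hxv, hzv]; omega
    have hne : z μ - x μ ≠ 0 := by
      intro h0
      have : (z μ - x μ).val = 0 := by rw [h0, ZMod.val_zero]
      omega
    have hgt : ¬ (x μ - z μ).val ≤ (z μ - x μ).val := by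
      have : (x μ - z μ) = -(z μ - x μ) := by ring
      rw [this, ZMod.neg_val, if_neg hne, hsub]
      omega
    rw [if_neg hgt, hsub]
    have hcount : (((P.L - 1) / 2 - off x μ : ℕ) : ℝ) ≤ (((P.L - 1) / 2 : ℕ) : ℝ) := by
      exact_mod_cast (show (P.L - 1) / 2 - off x μ ≤ (P.L - 1) / 2 by omega)
    refine (dist1_bwdHol_le U μ _ z fun i hi => hU _ ?_).trans (mul_le_mul_of_nonneg_right hcount hτ)
    exact unshiftN_mem_radialBonds hj hz hlow (by omega) i (by omega)

/-- THE WHOLE CONTOUR in `dist1`: along a decreasing, downward-closed list of coordinates, starting from a site of `B(y)` which sits at the centre in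
the listed coordinates, the path to `x ∈ B(y)` is `|l|·((L−1)∕2)·τ`-close to `1` (pub-balaban3d's `pathHol_eq_one` in `dist1`). [folklore] -/
theorem dist1_pathHol_le (hj : j + 1 ≤ P.m + P.K) {y : Site P (j + 1)} (U : GaugeField P j G) {τ : ℝ} (hτ : 0 ≤ τ)
    (hU : ∀ b ∈ radialBonds ({y} : Finset (Site P (j + 1))), dist1 (U b) ≤ τ) {x : Site P j} (hx : blockOf x = y) :
    ∀ (l : List (Fin P.d)), l.Pairwise (· > ·) → (∀ μ ∈ l, ∀ κ, κ < μ → κ ∈ l) →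
      ∀ z : Site P j, blockOf z = y → (∀ κ ∈ l, off z κ = (P.L - 1) / 2) →
        dist1 (pathHol U x l z) ≤ (l.length : ℝ) * ((((P.L - 1) / 2 : ℕ) : ℝ) * τ)
  | [], _, _, _, _, _ => by simp [pathHol, GaugeGroup.dist1_one]
  | μ :: l, hsort, hclosed, z, hz, hctr => by
    rw [List.pairwise_cons] at hsort
    have hlowμ : ∀ κ, κ < μ → off z κ = (P.L - 1) / 2 := fun κ hκ =>
      hctr κ (hclosed μ List.mem_cons_self κ hκ)
    have hmove := dist1_moveHol_le hj U hτ hU hz hx hlowμ (hctr μ List.mem_cons_self)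
    -- the next point: `z` with coordinate `μ` set to `x μ`
    have hrest : dist1 (pathHol U x l (Function.update z μ (x μ))) ≤ (l.length : ℝ) * ((((P.L - 1) / 2 : ℕ) : ℝ) * τ) := by
      refine dist1_pathHol_le hj U hτ hU hx l hsort.2 ?_ (Function.update z μ (x μ)) ?_ ?_
      · intro μ' hμ' κ hκ
        have hκl : κ ∈ μ :: l := hclosed μ' (List.mem_cons_of_mem _ hμ') κ hκ
        rcases List.mem_cons.1 hκl with rfl | h
        · exact absurd (hsort.1 μ' hμ') (by omega)
        · exact h
      · funext κ
        apply ZMod.val_injective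
        rw [Site.val_blockOf hj]
        by_cases hκ : κ = μ
        · subst hκ; simp only [Function.update_self]; rw [← Site.val_blockOf hj, hx]
        · rw [Function.update_of_ne hκ, ← Site.val_blockOf hj, hz]
      · intro κ hκ
        have hne : κ ≠ μ := fun h => by subst h; exact absurd (hsort.1 κ hκ) (lt_irrefl _)
        unfold off; rw [Function.update_of_ne hne]; exact hctr κ (List.mem_cons_of_mem _ hκ)
    simp only [pathHol, List.length_cons]
    calc dist1 (moveHol U μ (x μ) z * pathHol U x l (Function.update z μ (x μ)))
        ≤ dist1 (moveHol U μ (x μ) z) + dist1 (pathHol U x l (Function.update z μ (x μ))) := GaugeGroup.dist1_mul_le _ _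
      _ ≤ (((P.L - 1) / 2 : ℕ) : ℝ) * τ + (l.length : ℝ) * ((((P.L - 1) / 2 : ℕ) : ℝ) * τ) := add_le_add hmove hrest
      _ = ((l.length + 1 : ℕ) : ℝ) * ((((P.L - 1) / 2 : ℕ) : ℝ) * τ) := by push_cast; ring

/-- ★★ **THE RADIAL CONTOUR HOLONOMY IN `dist1`**: if every bond of the radial forest of `B(y)` is `τ`-close to `1`, then for `x ∈ B(y)`,
`dist1 (U(Γ_{y,x})) ≤ d · ((L−1)∕2) · τ` (the contour has at most `(L−1)∕2` bonds per coordinate). [cite: Balaban1984PropagatorsI, (1.7) p.18; folklore] -/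
theorem dist1_radialHol_le (hj : j + 1 ≤ P.m + P.K) {y : Site P (j + 1)} (U : GaugeField P j G) {τ : ℝ} (hτ : 0 ≤ τ)
    (hU : ∀ b ∈ radialBonds ({y} : Finset (Site P (j + 1))), dist1 (U b) ≤ τ) {x : Site P j} (hx : blockOf x = y) :
    dist1 (radialHol U y x) ≤ (P.d : ℝ) * ((((P.L - 1) / 2 : ℕ) : ℝ) * τ) := by
  unfold radialHol
  have h := dist1_pathHol_le hj U hτ hU hx (coordsDesc P) ?_ ?_ (emb y) (Site.blockOf_emb hj y) ?_
  · have hlen : (coordsDesc P).length = P.d := by simp [coordsDesc]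
    rw [hlen] at h
    exact h
  · unfold coordsDesc
    rw [List.pairwise_reverse]
    exact List.pairwise_lt_finRange P.d
  · intro μ _ κ _; simp [coordsDesc]
  · intro κ _; exact off_emb hj y κ

/-- A bond of the radial forest of `B(y)` has BOTH ends in `B(y)` (`RadialForest.blockOf_shift`). [folklore] -/
theorem blockOf_tgt_of_mem_radialBonds (hj : j + 1 ≤ P.m + P.K) {y : Site P (j + 1)} {b : PBond P j}
    (hb : b ∈ radialBonds ({y} : Finset (Site P (j + 1)))) : blockOf b.src = y ∧ blockOf b.tgt = y := by
  rw [mem_radialBonds, Finset.mem_singleton] at hb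
  refine ⟨hb.1, ?_⟩
  show blockOf (b.src.shift b.dir) = y
  rw [blockOf_shift hj b.src b.dir hb.2.1, hb.1]

end Segments

/-! ## §2  The within-block letter in the radial axial gauge -/

section Supplier

/-- ★★★ **THE WITHIN-BLOCK LETTER IN THE RADIAL AXIAL GAUGE** (road (S) of dag-n07-e g21's word; [6] p.79–80 «|V′_b − 1| < (d−1)(L−1)·…» in a crude
edition).  Let `W` be axial for the contours `Γ_{y,x}` of [B5] (1.7) (`AxialGauge (radialContourData P j G) W`) and let every plaquette based in the
block `B(y)` satisfy `dist1 (W(∂q)) < a`, `a ≥ 0`.  Then every bond `b` with both ends in `B(y)` satisfies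
`dist1 (W b) ≤ (d(L−1)+1)·(d−1)(L−1)·a`.  Proof: conjugation by g0's block-wise axial gauge `g` (`exists_blockwiseGauge`): `g(x)⁻¹ = (W^g)(Γ_{y,x})`
is `d((L−1)∕2)(d−1)(L−1)a`-close to `1` for `x ∈ B(y)`, and `W b = g(b₋)⁻¹ · (W^g b) · g(b₊)`.
[cite: Balaban1985RegularSpaces, (1.15) p.78, pp.79–80 (proof of Lemma 1); Balaban1984PropagatorsI, (1.7) p.18] -/
theorem dist1_le_of_axialGauge_radial (hj : j + 1 ≤ P.m + P.K) (W : GaugeField P j G)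
    (hW : AxialGauge (radialContourData P j G) W) {a : ℝ} (ha : 0 ≤ a) (y : Site P (j + 1))
    (hplaq : ∀ q : Plaq P j, blockOf q.src = y → dist1 (GaugeField.plaqHol W q) < a)
    (b : PBond P j) (hsrc : blockOf b.src = y) (htgt : blockOf b.tgt = y) :
    dist1 (W b) ≤ ((P.d * (P.L - 1) + 1 : ℕ) : ℝ) * ((((P.d - 1 : ℕ) : ℝ) * ((P.L - 1 : ℕ) : ℝ)) * a) := by
  classical
  obtain ⟨g, hg1, hg2, -⟩ := exists_blockwiseGauge hj W
  set τ : ℝ := ((P.d - 1 : ℕ) : ℝ) * ((P.L - 1 : ℕ) : ℝ) * a with hτdef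
  have hτ : 0 ≤ τ := by positivity
  -- every bond of `B(y)` of `W^g` is `τ`-close to `1`; in particular the radial forest
  have hWg : ∀ b' : PBond P j, blockOf b'.src = y → blockOf b'.tgt = y → dist1 (gaugeAct g W b') ≤ τ :=
    fun b' h1 h2 => hg2 a ha y hplaq b' h1 h2
  have hforest : ∀ b' ∈ radialBonds ({y} : Finset (Site P (j + 1))), dist1 (gaugeAct g W b') ≤ τ := fun b' hb' =>
    let h := blockOf_tgt_of_mem_radialBonds hj hb'
    hWg b' h.1 h.2
  -- `g(x)⁻¹ = (W^g)(Γ_{y,x})`, hence `dist1 (g x) ≤ d·((L−1)∕2)·τ` on `B(y)`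
  have hgx : ∀ x : Site P j, blockOf x = y → dist1 (g x) ≤ (P.d : ℝ) * ((((P.L - 1) / 2 : ℕ) : ℝ) * τ) := by
    intro x hx
    by_cases hxc : x = emb y
    · rw [hxc, hg1 y, GaugeGroup.dist1_one]; positivity
    · have hax : radialHol W y x = 1 := hW y x hx hxc
      have hcov : radialHol (gaugeAct g W) y x = (g x)⁻¹ := by
        rw [radialHol_gaugeAct, hax, hg1 y, one_mul, one_mul]
      have h := dist1_radialHol_le hj (gaugeAct g W) hτ hforest hx
      rw [hcov, GaugeGroup.dist1_inv] at h
      exact h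
  -- `W b = g(b₋)⁻¹ (W^g b) g(b₊)`
  have hWb : W b = (g b.src)⁻¹ * gaugeAct g W b * g b.tgt := by
    simp only [gaugeAct, GaugeField.gaugeAct]; group
  have hd2 : (2 : ℝ) * (((P.L - 1) / 2 : ℕ) : ℝ) ≤ ((P.L - 1 : ℕ) : ℝ) := by
    exact_mod_cast (show 2 * ((P.L - 1) / 2) ≤ P.L - 1 from Nat.mul_div_le (P.L - 1) 2)
  rw [hWb]
  calc dist1 ((g b.src)⁻¹ * gaugeAct g W b * g b.tgt)
      ≤ dist1 ((g b.src)⁻¹ * gaugeAct g W b) + dist1 (g b.tgt) := GaugeGroup.dist1_mul_le _ _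
    _ ≤ dist1 ((g b.src)⁻¹) + dist1 (gaugeAct g W b) + dist1 (g b.tgt) := by
        linarith [GaugeGroup.dist1_mul_le (g b.src)⁻¹ (gaugeAct g W b)]
    _ ≤ (P.d : ℝ) * ((((P.L - 1) / 2 : ℕ) : ℝ) * τ) + τ + (P.d : ℝ) * ((((P.L - 1) / 2 : ℕ) : ℝ) * τ) := by
        rw [GaugeGroup.dist1_inv]
        exact add_le_add (add_le_add (hgx _ hsrc) (hWg b hsrc htgt)) (hgx _ htgt)
    _ ≤ ((P.d * (P.L - 1) + 1 : ℕ) : ℝ) * τ := by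
        push_cast
        have hd0 : (0 : ℝ) ≤ P.d := by positivity
        nlinarith [mul_nonneg hd0 hτ]

/-- The same in the shape of the `hint` binder of g0's `…Lemma1CrossingBondsAtRecord.dist1_crossingBond_le_at_record` (one block: both ends in the SAME
block, that block being `B(y)`). [cite: Balaban1985RegularSpaces, pp.79–80 (proof of Lemma 1)] -/
theorem dist1_le_of_axialGauge_radial_hint (hj : j + 1 ≤ P.m + P.K) (W : GaugeField P j G)
    (hW : AxialGauge (radialContourData P j G) W) {a : ℝ} (ha : 0 ≤ a) (y : Site P (j + 1))
    (hplaq : ∀ q : Plaq P j, blockOf q.src = y → dist1 (GaugeField.plaqHol W q) < a) :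
    ∀ b : PBond P j, blockOf b.src = blockOf b.tgt → blockOf b.src = y →
      dist1 (W b) ≤ ((P.d * (P.L - 1) + 1 : ℕ) : ℝ) * ((((P.d - 1 : ℕ) : ℝ) * ((P.L - 1 : ℕ) : ℝ)) * a) :=
  fun b hst hsrc => dist1_le_of_axialGauge_radial hj W hW ha y hplaq b hsrc (hst ▸ hsrc)

end Supplier

end Summit.QuantumFields.YangMills.BalabanUVNodes.N07RadialGaugeWithinBlock

end
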